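import Literature.Computability.QuantumComplexity.CubicForrelationMem
import Literature.Computability.MetaComplexity.RandReductionsLeak
import Literature.Computability.Complexity.PromiseZPPProofs

/-!
# `CubicForrelationInPrBPP` — negative knowledge: `PromiseBPP'` is a proper class; every cubic rung is barrier-protected

Support file for crux `stmt-QuantumAdvantage-2204`
(`Summit.QuantumAdvantage.QuantumAdvantage.Theses.CubicForrelation.CubicForrelationInPrBPP` =
`cubicKForrelationProblem 2 ∈ PromiseBPP'`, a THEOREM of the tree:
`CubicDequant.cubicKForrelationProblem_two_mem_PromiseBPP'`), written by the standing disprover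
refuter-cdisprove-stmt-QuantumAdvantage-2204-g3-0 (2026-08-16). Two cheap facts a refuter owes on a PROVED membership claim:

* it is not a theorem for a junk reason — the class is proper: `exists_ofLanguage_not_mem_PromiseBPP'`,
  `exists_disjoint_not_mem_PromiseBPP'` (Cantor: `BPP` is countable, tree `MetaComplexity.countable_BPP`, the
  length sets `{x | |x| ∈ H}` are uncountably many languages, and on a trivial promise `PromiseBPP'` is `BPP`,
  tree `ofLanguage_mem_PromiseBPP'_iff`); together with `Negative/NoJunk.lean` (both sides inhabited, disjoint)
  the membership carries content;
* no rung of the cubic ladder can be put OUTSIDE `PromiseBPP'` short of a class separation: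
  `not_mem_cubicKForrelationProblem_imp_separation k₀` (from the tree's `cubicKForrelationProblem_mem_PromiseBQP k₀`),
  in particular the route's tenure restatement `k₀ = 3`.

## References

* [AroraBarak2009] S. Arora, B. Barak, Computational Complexity, CUP 2009, §1.4 (machines as strings), Def. 7.3.
* [Goldreich2006] O. Goldreich, On promise problems, 2006, Def. 1.2.
* [AaronsonAmbainis2018] S. Aaronson, A. Ambainis, Forrelation, SIAM J. Comput. 47 (2018), §6.
-/

noncomputable section

set_option linter.dupNamespace false -- D-0017: single-problem summit ⇒ `QuantumAdvantage.QuantumAdvantage` by design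

namespace Summit.QuantumAdvantage.QuantumAdvantage.Theorems.CubicForrelationInPrBPP.Negative

open Literature.Computability.QuantumComplexity Literature.Computability.Complexity
  Literature.Computability.Cryptography

/-- **`PromiseBPP'` is not everything**: some language, as a total promise problem, lies outside
`PromiseBPP'`. [folklore] -/
theorem exists_ofLanguage_not_mem_PromiseBPP' :
    ∃ L : Language Bool, PromiseProblem.ofLanguage L ∉ PromiseBPP' := by
  by_contra h
  push Not at h
  have huniv : (Set.univ : Set (Set ℕ)).Countable :=
    Set.MapsTo.countable_of_injOn (f := Literature.Computability.MetaComplexity.lengthSet)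
      (fun H _ => ofLanguage_mem_PromiseBPP'_iff.1 (h _))
      Literature.Computability.MetaComplexity.lengthSet_injective.injOn
      Literature.Computability.MetaComplexity.countable_BPP
  haveI : Countable (Set ℕ) := Set.countable_univ_iff.1 huniv
  obtain ⟨f, hf⟩ := Countable.exists_injective_nat (Set ℕ)
  exact Function.cantor_injective f hf

/-- … in particular there are DISJOINT (genuine) promise problems outside `PromiseBPP'`. [folklore] -/
theorem exists_disjoint_not_mem_PromiseBPP' :
    ∃ Q : PromiseProblem, Q.Disjoint ∧ Q ∉ PromiseBPP' := by
  obtain ⟨L, hL⟩ := exists_ofLanguage_not_mem_PromiseBPP'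
  refine ⟨PromiseProblem.ofLanguage L, ?_, hL⟩
  show _root_.Disjoint L Lᶜ
  exact disjoint_compl_right

/-- **Every rung of the cubic ladder is barrier-protected**: for every `k₀`, putting cubic
`k₀`-fold Forrelation outside `PromiseBPP'` separates `PromiseBQP` from `PromiseBPP'`.
[cite: AaronsonAmbainis2018, §6] -/
theorem not_mem_cubicKForrelationProblem_imp_separation (k₀ : ℕ)
    (h : cubicKForrelationProblem k₀ ∉ PromiseBPP') : ¬ (PromiseBQP ⊆ PromiseBPP') :=
  fun hsub => h (hsub (cubicKForrelationProblem_mem_PromiseBQP k₀))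

end Summit.QuantumAdvantage.QuantumAdvantage.Theorems.CubicForrelationInPrBPP.Negative

end
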